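import Summits.QuantumFields.YangMills.Theorems.FluctuationComparisonRegPrIntLHeightwiseQuotientOfPackageV3
import Summits.QuantumFields.YangMills.Theorems.FluctuationComparisonRegPrIntLPersistenceFromThm1
import Summits.QuantumFields.YangMills.Theorems.FluctuationComparisonRegPrIntLTubeFromThm1
import HarnessLib

/-!
# PERS₁∘ AND TUBE∘ OF THE PERSISTENCE ORGAN, TEXTS VERBATIM, FROM THE GUARDED v3 RECORD SOCKET OF R3 ALONE

Cell `ym3-torus` (YM ladder rung R3 = continuum `SU(2)` Yang–Mills on the three-torus — a RUNG, NOT d = 4, NOT infinite volume, NOT a mass gap, NOT Clay).  Width seat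
`ym-ust-20520-w3` (gen 19, LEAD-20520 by lineage); `--supports stmt-QuantumFields-20520 --as helper`, count-neutral, definition-free, default heartbeats.

WHAT.  The persistence leaf of S2β's LFR♯ᶜ∘ (ideator LINE g22-4∕g23-x `Lines/persistence_geometry.lean` rows PERS₁∘ `OneLevelPersistenceIntCan`, TUBE∘ `SectionTubeMassIntCan`) was
reduced by the lane to Bałaban's Thm 1 (5) read heightwise (★★OWNER 2026-08-30 08:05:20Z): PERS₁∘ ⟸ ⟨UP⟩ + ⟨LOW on `θBal(c·b₀)`⟩ (LEAD g18 ✓`…PersistenceFromThm1.oneLevelPersistenceIntCan_of_heightwiseBounds`),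
TUBE∘ ⟸ ⟨UP⟩ + ⟨LOW on `2·θBal(b₀)`⟩ (w4-20520 ✓`…TubeFromThm1.sectionTubeMassIntCan_of_heightwiseBounds`).  ✓`…HeightwiseQuotientOfPackageV3.stabilityCans_of_v3Rec` (this seat,
over ym3-torus-px8 g15's B25-at-every-level and w4-20520's ⟨MAIN-H⟩) gives ⟨UP⟩ = UP∘ and the windowed lower quotient LOWB∘ for EVERY profile `(b₀', p₀')` beyond the socket's
thresholds `(bB, pB)`, from the guarded record socket `∀ L, Odd L → 1 < L → AlphaInputsT3ACv3Rec L` ALONE.  THIS FILE feeds the two consumers: the organ's window at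
`(c·b₀, p₀)` resp. `(2b₀, p₀)` lies INSIDE LOWB∘'s window at the profile `(max (2b₀) bB, p₀)` (`θBal` is linear in `b₀`, lit ✓`T3InteriorExcision.θBal_mul_le`; `pS := pB`), so the
lower letter transfers by monotonicity of the event; `γ₁ := min γ₁ᵁ γ₁ᴸ`.
* §1 ★★★★ `upLow_of_v3Rec` — the consumers' common hypothesis bundle (⟨UP⟩ ∧ ⟨LOW on `θBal(t, p₀, J+1)`⟩ for both `t = c·b₀` and `t = 2b₀`), in PERS₁∘'s prefix, from the socket.
* §2 ★★★★★ `oneLevelPersistenceIntCan_of_v3Rec` — **PERS₁∘ (text VERBATIM = ✓p766163's conclusion) ⟸ `∀ L, Odd L → 1 < L → AlphaInputsT3ACv3Rec L`**;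
  ★★★★★ `sectionTubeMassIntCan_of_v3Rec` — **TUBE∘ (text VERBATIM = ✓p766221's conclusion) ⟸ the same socket**.

NET FOR THE CENSUS.  The persistence leaf {PERS₁∘, TUBE∘} of LFR♯ᶜ∘ is CONDITIONAL ON THE (α)-v3 SOCKET OF RECORD ONLY — the socket PATH A∕B already display (via 19936∕S2α′);
no Thm-1 row, no large-field row, no main-term row, no counterterm row remains displayed on this leaf.  Seats by name: alpha-1 (socket), px8 g15 (B25 every level), w8∕px20
(hTop), w4-20520 (⟨MAIN-H⟩, TUBE knit), px12∕w6∕px13 (`n = 0` templates), w5-20520 (print reading, №42), px21∕px8∕px20 g11 (K-free letters), ideator g22∕g23 (row texts), this seat.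

HONEST SCOPE.  A knit over landed theorems; CONDITIONAL on the OPEN v3 (α) package (the UV3 node's inputs); nothing of Theorem 1, of the socket, of LFR♯ᶜ∘∕S2β, of
`FluctuationComparisonRegPrIntL` (20520) or of the rung is proved; no summit is proved by a helper; rung R3 = SU(2) YM₃ on T³ — NOT d = 4, NOT infinite volume, NOT a mass gap,
NOT Clay.  Sorry-free, axioms standard.

References: T. Bałaban, CMP **102** (1985) 255–275 [Balaban1985UV3] ((4)–(7) pp.256–257, Thm 1 p.257, (41) p.266, (47) p.267); T. Bałaban, CMP **102** (1985) 277–309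
[Balaban1985Variational] (Thm 1 p.279); T. Bałaban, CMP **98** (1985) 17–51 [Balaban1985Averaging] ((10) p.19).
-/

set_option autoImplicit false

noncomputable section

namespace Summit.QuantumFields.YangMills.Theorems.FluctuationComparisonRegPrIntLPersistenceOfPackageV3

open MeasureTheory
open Literature.MathematicalPhysics.QuantumFieldTheory.Balaban1983to89
open Literature.MathematicalPhysics.QuantumFieldTheory.Balaban1983to89.T3ContinuumYM3Torus
open Literature.MathematicalPhysics.QuantumFieldTheory.Balaban1983to89.T3UnitLawDensityEML (ℰp)
open Literature.MathematicalPhysics.QuantumFieldTheory.Balaban1983to89.T3UnitScaleTilt (θBal gibbsK)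
open Literature.MathematicalPhysics.QuantumFieldTheory.Balaban1983to89.T3TiltDescent (heightDensity descendTo)
open Literature.MathematicalPhysics.QuantumFieldTheory.Balaban1983to89.T3HeightwiseDensityBounds
open Literature.MathematicalPhysics.QuantumFieldTheory.Balaban1983to89.Missing (partitionFn)
open Summit.QuantumFields.YangMills.Theorems.FluctuationComparisonRegPrIntLHeightwiseQuotientOfPackageV3 (stabilityCans_of_v3Rec)

/-! ## §1 The consumers' ⟨UP⟩ + ⟨LOW⟩ bundle from the record socket, by window monotonicity -/

/-- **A window at profile `t ≤ b` lies inside the window at profile `b`**: `θBal L γ t p₀ n ≤ θBal L γ b p₀ n` for `0 < t ≤ b` (`θBal` linear in the profile constant,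
lit ✓`θBal_mul_le` at `c := t∕b ≤ 1`). [cite: Balaban1985UV3, (7) p.257] -/
theorem θBal_le_of_profile_le {L : ℕ} (hL : 1 ≤ L) {γ : ℝ} (hγ : 0 < γ) (hγ1 : γ ≤ 1) {t b : ℝ} (ht : 0 < t) (htb : t ≤ b) (p₀ : ℝ) (n : ℕ) :
    θBal L γ t p₀ n ≤ θBal L γ b p₀ n := by
  have hb : 0 < b := lt_of_lt_of_le ht htb
  have h := T3InteriorExcision.θBal_mul_le hL hγ hγ1 hb (div_le_one_of_le₀ htb hb.le) p₀ n (c := t / b)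
  rwa [div_mul_cancel₀ t hb.ne'] at h

/-- ★★★★ **⟨UP⟩ ∧ ⟨LOW ON A SUB-PROFILE WINDOW⟩ IN PERS₁∘'s PREFIX, FROM THE RECORD SOCKET**: for any profile map `t` with `0 < t c b₀ ≤ 2·b₀`-type control given as
`ht : ∀ c b₀, 0 < c → 0 < b₀ → 0 < t c b₀` and the LOWB∘ profile `max (t c b₀) bB`: `∀ L, ∃ c₀ = 1, ∀ c ∈ (0,1], ∃ pS := pB, ∀ b₀ > 0, ∀ p₀ ≥ pS, p₀ > 0 → ∃ γ₁ > 0, ∀ F γ, F.L = L →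
0 < γ ≤ γ₁ → HeightwiseUpperBound F γ ∧ ∀ J, ∃ cl > 0, ∀ K ≥ J+1, ∀ᵐ V, PlaqSmall (θBal F.L γ (t c b₀) p₀ (J+1)) V → cl ≤ Z_K⁻¹·heightDensity …` — UP∘ and LOWB∘
(✓`stabilityCans_of_v3Rec`) at the profile `(max (t c b₀) bB, p₀)`, the event shrunk by `θBal_le_of_profile_le`. [cite: Balaban1985UV3, (4)–(7) pp.256–257, (47) p.267] -/
theorem upLow_of_v3Rec (hrec : ∀ L : ℕ, Odd L → 1 < L → AlphaInputsT3ACv3Rec L) (t : ℝ → ℝ → ℝ)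
    (ht : ∀ c b₀ : ℝ, 0 < c → 0 < b₀ → 0 < t c b₀) :
    ∀ (L : ℕ), ∃ c₀ : ℝ, 0 < c₀ ∧ c₀ ≤ 1 ∧ ∀ (c : ℝ), 0 < c → c ≤ c₀ → ∃ pS : ℝ, ∀ (b₀ p₀ : ℝ), 0 < b₀ → pS ≤ p₀ → 0 < p₀ →
      ∃ γ₁ : ℝ, 0 < γ₁ ∧ ∀ (F : T3Family) (γ : ℝ), F.L = L → 0 < γ → γ ≤ γ₁ →
        HeightwiseUpperBound F γ ∧
        ∀ (J : ℕ), ∃ cl : ℝ, 0 < cl ∧ ∀ (K : ℕ) (hJK : J + 1 ≤ K),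
          ∀ᵐ V ∂(fieldMeasure (F.P (J + 1)) 0 (Matrix.specialUnitaryGroup (Fin 2) ℂ)), PlaqSmall (θBal F.L γ (t c b₀) p₀ (J + 1)) V →
            cl ≤ (partitionFn (G := Matrix.specialUnitaryGroup (Fin 2) ℂ) (F.P K) ((F.scheme ℰp γ).β K))⁻¹ * heightDensity F γ hJK Set.univ V := by
  obtain ⟨hUP, hLOW⟩ := stabilityCans_of_v3Rec hrec
  intro L
  obtain ⟨γU, hγU, hU⟩ := hUP L
  obtain ⟨bB, pB, hBP⟩ := hLOW L
  refine ⟨1, one_pos, le_rfl, fun c hc _ => ⟨pB, fun b₀ p₀ hb₀ hpB hp₀ => ?_⟩⟩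
  -- LOWB∘ at the profile `(max (t c b₀) bB, p₀)`
  obtain ⟨γL, hγL, hLw⟩ := hBP (max (t c b₀) bB) p₀ (le_max_right _ _) hpB
  refine ⟨min γU γL, lt_min hγU hγL, fun F γ hFL hγ hγle => ?_⟩
  have hγU' : γ ≤ γU := hγle.trans (min_le_left _ _)
  have hγL' : γ ≤ γL := hγle.trans (min_le_right _ _)
  refine ⟨hU F γ hFL hγ hγU', fun J => ?_⟩
  obtain ⟨cl, hcl, hK⟩ := hLw F γ hFL hγ hγL' (J + 1)
  refine ⟨cl, hcl, fun K hJK => ?_⟩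
  -- `γ ≤ 1` for the monotonicity lemma: `γ ≤ γU`? not needed — use `θBal_le_of_profile_le` needs `γ ≤ 1`; obtain it from the record window via `hU`? We only know
  -- `0 < γ`; so bound instead through linearity, valid for every `γ > 0`:
  have hmono : ∀ V : GaugeField (F.P (J + 1)) 0 (Matrix.specialUnitaryGroup (Fin 2) ℂ),
      PlaqSmall (θBal F.L γ (t c b₀) p₀ (J + 1)) V → PlaqSmall (θBal F.L γ (max (t c b₀) bB) p₀ (J + 1)) V := by
    intro V hV q
    refine lt_of_lt_of_le (hV q) ?_
    -- `θBal (t) = (t / M)·θBal(M)` with `M := max t bB ≥ t > 0`; and `θBal(M) ≥ 0` iff … ; we argue on the sign of `θBal(M)`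
    have htpos : 0 < t c b₀ := ht c b₀ hc hb₀
    have hM : 0 < max (t c b₀) bB := lt_of_lt_of_le htpos (le_max_left _ _)
    have hlin : θBal F.L γ (t c b₀) p₀ (J + 1) = (t c b₀ / max (t c b₀) bB) * θBal F.L γ (max (t c b₀) bB) p₀ (J + 1) := by
      rw [← T3InteriorExcision.θBal_mul, div_mul_cancel₀ _ hM.ne']
    by_cases hnn : 0 ≤ θBal F.L γ (max (t c b₀) bB) p₀ (J + 1)
    · rw [hlin]
      exact mul_le_of_le_one_left hnn (div_le_one_of_le₀ (le_max_left _ _) hM.le)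
    · -- a negative window radius makes the hypothesis `hV q : dist1 … < θBal(t) = (t/M)·θBal(M) < 0` impossible (`dist1 ≥ 0`)
      exfalso
      have hq := hV q
      rw [hlin] at hq
      have hdn : 0 ≤ GaugeGroup.dist1 (GaugeField.plaqHol V q) := GaugeGroup.dist1_nonneg _
      have : (t c b₀ / max (t c b₀) bB) * θBal F.L γ (max (t c b₀) bB) p₀ (J + 1) < 0 :=
        mul_neg_of_pos_of_neg (div_pos htpos hM) (lt_of_not_ge hnn)
      linarith
  filter_upwards [hK K hJK] with V hV hsmall
  exact hV (hmono V hsmall)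

/-! ## §2 PERS₁∘ and TUBE∘, texts verbatim, from the record socket alone -/

/-- ★★★★★ **PERS₁∘ — ONE-LEVEL PERSISTENCE OF SMALLNESS UNDER THE DESCENDED GIBBS MEASURES (the organ row `OneLevelPersistenceIntCan`, text = ✓p766163's conclusion VERBATIM) FROM
THE GUARDED v3 RECORD SOCKET OF R3 ALONE**: LEAD g18's ✓`oneLevelPersistenceIntCan_of_heightwiseBounds` fed by `upLow_of_v3Rec` at the profile map `t c b₀ := c·b₀`.
[cite: Balaban1985UV3, (4)–(7) pp.256–257, Thm 1 p.257, (41) p.266, (47) p.267; Balaban1985Variational, Thm 1 p.279] -/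
theorem oneLevelPersistenceIntCan_of_v3Rec (hrec : ∀ L : ℕ, Odd L → 1 < L → AlphaInputsT3ACv3Rec L) :
    ∀ (L : ℕ), ∃ c₀ : ℝ, 0 < c₀ ∧ c₀ ≤ 1 ∧ ∀ (c : ℝ), 0 < c → c ≤ c₀ → ∃ pS : ℝ, ∀ (b₀ p₀ : ℝ), 0 < b₀ → pS ≤ p₀ → 0 < p₀ →
      ∃ γ₁ : ℝ, 0 < γ₁ ∧ ∀ (F : T3Family) (γ : ℝ), F.L = L → 0 < γ → γ ≤ γ₁ →
        ∀ (J : ℕ), ∃ q : ℝ, 0 < q ∧ ∀ (K : ℕ) (hJK : J + 1 ≤ K)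
          (B : Set (GaugeField (F.P J) 0 (Matrix.specialUnitaryGroup (Fin 2) ℂ))), MeasurableSet B →
            B ⊆ {U | PlaqSmall (θBal F.L γ (c * b₀) p₀ J) U} →
            ENNReal.ofReal q * gibbsK F ℰp γ K (descendTo F ℰp J K ((Nat.le_succ J).trans hJK) ⁻¹' B) ≤
              gibbsK F ℰp γ K (descendTo F ℰp J K ((Nat.le_succ J).trans hJK) ⁻¹' B ∩
                descendTo F ℰp (J + 1) K hJK ⁻¹' {V | PlaqSmall (θBal F.L γ (c * b₀) p₀ (J + 1)) V}) :=
  FluctuationComparisonRegPrIntLPersistenceFromThm1.oneLevelPersistenceIntCan_of_heightwiseBounds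
    (upLow_of_v3Rec hrec (fun c b₀ => c * b₀) fun _ _ hc hb₀ => mul_pos hc hb₀)

/-- ★★★★★ **TUBE∘ — THE SECTION-TUBE MASS INEQUALITY (the organ row `SectionTubeMassIntCan`, text = ✓p766221's conclusion VERBATIM) FROM THE GUARDED v3 RECORD SOCKET OF R3
ALONE**: w4-20520's ✓`sectionTubeMassIntCan_of_heightwiseBounds` fed by `upLow_of_v3Rec` at the profile map `t c b₀ := 2·b₀` (`2·θBal(b₀) = θBal(2b₀)`, lit ✓`θBal_mul`).
[cite: Balaban1985UV3, (4)–(7) pp.256–257, Thm 1 p.257, (41) p.266, (47) p.267; Balaban1985Averaging, (10) p.19] -/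
theorem sectionTubeMassIntCan_of_v3Rec (hrec : ∀ L : ℕ, Odd L → 1 < L → AlphaInputsT3ACv3Rec L) :
    ∀ (L : ℕ), ∃ c₀ : ℝ, 0 < c₀ ∧ c₀ ≤ 1 ∧ ∀ (c : ℝ), 0 < c → c ≤ c₀ → ∃ pS : ℝ, ∀ (b₀ p₀ : ℝ), 0 < b₀ → pS ≤ p₀ → 0 < p₀ →
      ∃ γ₁ : ℝ, 0 < γ₁ ∧ ∀ (F : T3Family) (γ : ℝ), F.L = L → 0 < γ → γ ≤ γ₁ →
        ∀ (J : ℕ) (r : ℝ), 0 < r →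
          ∀ σ : GaugeField (F.P J) 0 (Matrix.specialUnitaryGroup (Fin 2) ℂ) → GaugeField (F.P (J + 1)) 0 (Matrix.specialUnitaryGroup (Fin 2) ℂ), Measurable σ →
            (∀ U : GaugeField (F.P J) 0 (Matrix.specialUnitaryGroup (Fin 2) ℂ), PlaqSmall (θBal F.L γ (c * b₀) p₀ J) U →
              descendTo F ℰp J (J + 1) (Nat.le_succ J) (σ U) = U ∧ PlaqSmall (θBal F.L γ b₀ p₀ (J + 1)) (σ U)) →
            ∃ q : ℝ, 0 < q ∧ ∀ (K : ℕ) (hJK : J + 1 ≤ K)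
              (B : Set (GaugeField (F.P J) 0 (Matrix.specialUnitaryGroup (Fin 2) ℂ))), MeasurableSet B →
                B ⊆ {U | PlaqSmall (θBal F.L γ (c * b₀) p₀ J) U} →
                ENNReal.ofReal q * gibbsK F ℰp γ K (descendTo F ℰp J K ((Nat.le_succ J).trans hJK) ⁻¹' B) ≤
                  gibbsK F ℰp γ K (descendTo F ℰp J K ((Nat.le_succ J).trans hJK) ⁻¹' B ∩
                    {V | ∀ b : PBond (F.P (J + 1)) 0,
                      dist1 ((σ (descendTo F ℰp J K ((Nat.le_succ J).trans hJK) V) b)⁻¹ *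
                        descendTo F ℰp (J + 1) K hJK V b) < r}) := by
  have h := upLow_of_v3Rec hrec (fun _ b₀ => 2 * b₀) fun _ _ _ hb₀ => by positivity
  refine FluctuationComparisonRegPrIntLTubeFromThm1.sectionTubeMassIntCan_of_heightwiseBounds fun L => ?_
  obtain ⟨c₀, hc₀, hc₀1, hc⟩ := h L
  refine ⟨c₀, hc₀, hc₀1, fun c hcpos hcle => ?_⟩
  obtain ⟨pS, hpS⟩ := hc c hcpos hcle
  refine ⟨pS, fun b₀ p₀ hb₀ hpS' hp₀ => ?_⟩
  obtain ⟨γ₁, hγ₁, hF⟩ := hpS b₀ p₀ hb₀ hpS' hp₀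
  refine ⟨γ₁, hγ₁, fun F γ hFL hγ hγle => ?_⟩
  obtain ⟨hup, hlow⟩ := hF F γ hFL hγ hγle
  refine ⟨hup, fun J => ?_⟩
  obtain ⟨cl, hcl, hK⟩ := hlow J
  refine ⟨cl, hcl, fun K hJK => ?_⟩
  filter_upwards [hK K hJK] with V hV hsmall
  refine hV ?_
  rw [T3InteriorExcision.θBal_mul]
  exact hsmall

end Summit.QuantumFields.YangMills.Theorems.FluctuationComparisonRegPrIntLPersistenceOfPackageV3

end
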